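import Literature.MathematicalPhysics.QuantumFieldTheory.Balaban1983to89.B6RandomWalkHom
import Literature.MathematicalPhysics.QuantumFieldTheory.Balaban1983to89.B9Thm34Ext
import Literature.MathematicalPhysics.QuantumFieldTheory.Balaban1983to89.B9SectCDiffDict

/-!
# B9Thm37GlueCor36 — the inputs `h342_*` of the Theorem 3.7 glue lineage FROM the cell's typed Theorem 3.1 /
# Corollary 3.6 (`B9.Ineq342_346_347`, `B9.Cor36Printed`): the two typings of (3.42) in the cell, joined

[B9] T. Bałaban, *Propagators for lattice gauge theories in a background field*, Commun. Math. Phys. **99** (1985)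
389–434 [cite: Balaban1985BackgroundPropagators]; [4] = T. Bałaban, *Propagators and renormalization transformations
for lattice gauge theories. II*, Commun. Math. Phys. **96** (1984) 223–250 [cite: Balaban1984PropagatorsII].

CITATION HEADER (lean-in-tree rule 2026-08-18).  Cell `pub-balaban`, unit `b2b-balaban-pv21-g6` (SURGE NODE PROVER
#21, lineage pv21, gen 6), journal claim `HOM-342-RD`.  Source B9: doi:10.1007/bf01240355, held
`paper:balaban1985-cmp99-background-propagators`, journal page = PDF page + 388; renders READ AS IMAGES by this unit:
`run/shared/lean/pub/pub-balaban/b2b-balaban-ref1/pages/1985-cmp99-background-propagators/…-p009-x2.png` (p. 397),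
`…-p020-x2.png` (p. 408), `…-p021-x2.png` (p. 409); [4]: `…/1984-cmp96-propagators-rt-II/…-p010-x2.png` (p. 232).
p. 397, Theorem 3.1 (verbatim): *"There exist positive constants M₁, δ₀, a₀, B₀ dependent on d and L only, a constant
B₀(β) dependent on d, L and β, 0 ≦ β < 1 (B₀(β) → ∞ if β → 1), such that for M ≧ M₁ and for an arbitrary
configuration U satisfying the regularity condition (3.35) with Mα₀ ≦ a₀, the operator G′(U) (a = 1) satisfies the
inequalities |(G′(U)λ)(x)|, |(∇_U G′(U)λ)(x)|, |(G′(U)∇*_U λ)(x)|, |(Δ_U G′(U)λ)(x)| ≦ B₀[(L^jη)², L^jη, L^jη, 1]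
e^{−δ₀d(y,y′)}|λ| for x ∈ Δ(y), y ∈ Λ_j, supp λ ⊂ Δ(y′); (3.42)"*, with (3.39): *"|A| = max_μ sup_x |A_μ(x)|"*.
p. 408, Corollary 3.6 (verbatim): *"If a configuration U satisfies (3.35) with O(1)Mα₀ ≦ a₁, and Ω′₀ ⊂ □ for a
cube □ of the class described in this condition, then Theorems 3.1–3.3 hold for the operators G′(U),
(Q′(U)G′²(U)Q′*(U))^{−1}, G(U) constructed for the sequence {Ω′_j}."*; *"Corollary 3.6 gives crucial results for our
future considerations. We will prove Theorems 3.1–3.3 in full generality localizing them by generalized random walk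
expansions to small domains contained in cubes □, and then using the results of this corollary."*  p. 409
(verbatim): *"the sequence {Ω_n(□)} satisfies the assumptions of Corollary 3.6. The operators constructed for this
sequence, which we denote by G′_□(U), C_□(U) = (Q′(U)G′_□²(U)Q′*(U))^{−1}, G_□(U), satisfy all the inequalities of
Theorems 3.1–3.3 correspondingly. This is the basis of all estimates for the expansions we will construct."*
[4] p. 232 (verbatim): *"|(Rλ)(x)| ≦ O(M^{−1})e^{−δ₀d(x,y)}|λ| if supp λ ⊂ B^j(y), y ∈ Λ_j. (2.51)"*; *"Let us consider
n operators R₁, R₂, …, R_n satisfying (2.51) with a constant O(1) instead of O(M^{−1}) […] We consider (Rλ)(x) for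
x ∈ B^j(y), y ∈ Λ_j and supp λ ⊂ B^{j′}(y′), y′ ∈ Λ_{j′}."*

THE POINT.  The cell holds TWO typings of the printed inequality class (3.42) = [4] (2.51): (a) the b09 / r1 typing
over the ABSTRACT observation quantities of `B9.KernelFamily` (`K.e n U λ y` = the sup over x ∈ Δ(y) of the n-th
entry; `B9.Ineq342_346_347`, `B9.Thm31Printed`, `B9.Cor36Printed`), read into MATRICES by r1-g11's hypothesis
structure `B9SectCDiffDict.Realizes` and the block-row-sum class `B9SectCDiffEstimate.BlkMaj` (`blkMaj_of_ineq342`);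
(b) the pv08 / pv21 typing of [4] (2.51) for LINEAR MAPS between function lattices, `B6RandomWalk.HasMajorant` /
`B6RandomWalkHom.HasMajorantHom` (*"|(Tλ)(v)| ≦ K(y,y′)|λ|"* for block-supported sup-bounded sources), in which the
Theorem 3.7 glue lineage (`B9Thm37Glue` → `B9Thm37GlueT` → `B9Thm37GlueSt` → `B9Thm37GlueSz`, side leaf
`B9Thm37GlueQ`) takes Corollary 3.6 for the local operators G′_□ as its hypotheses `h342_1 … h342_4`.  The docstring
of `BlkMaj` calls it *"the matrix form of `B6RandomWalk.HasMajorant`"*, but no theorem joined the two.  THIS FILE is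
that join (§1: `hasMajorantHom_of_blkMaj`, `blkMaj_of_hasMajorantHom` — the representing matrix `LinearMap.toMatrix'`
of the linear map), whence (§2) the first conjunct of (3.42) AS TYPED, together with a realization of the operator by
the n-th observation quantity, gives the [4]-(2.51) majorant `maj342 g n B₀ δ₀` = B₀·[(L^jη)², L^jη, L^jη, 1]_n·
e^{−δ₀d} in exactly the four shapes the glue lineage consumes (`hasMajorant_e0_of_ineq342` = the shape of `h342_1`,
`hasMajorantHom_e1_of_ineq342` = `h342_2`, `…_e2_…` = `h342_3`, `…_e3_…` = `h342_4`), and (§3) Corollary 3.6 resp.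
Theorem 3.1 AS TYPED give them for every member of a family on one geometry, with the printed provisos — M ≧ M₁,
O(1)Mα₀ ≦ a₁ (resp. Mα₀ ≦ a₀), the regularity condition (3.35) — displayed as hypotheses
(`hasMajorantHom_of_cor36`, `hasMajorantHom_of_thm31`).  So the edge "Corollary 3.6 ⟶ `h342_*`" of the lineage's
input list is now a theorem over the cell's own typed nodes, modulo the READING `Realizes` (a hypothesis on how a
model instantiates the abstract carrier `Loc`, `suppIn`, `supNorm`, `e` — r1-g11's, not a new one).

v2 (APPEND-ONLY §4, same unit, journal claim HOM-342-RD-V2): the CONVERSE reading.  The glue lineage's OUTPUTS are again [4]-(2.51) majorants (`thm37_entry1…4_of_342_lattice_of_387_sz`: G′ = Σ_ω…, ∇G′, G′∇*, ΔG′ with majorants C_n·[(L^jη)², L^jη, L^jη, 1]_n·e^{−δ′_n d}, δ′_n ∈ {(1−α)δ₀, (1−2α)δ₀}), while the cell's typed Theorem 3.1 (`B9.Thm31Printed` ∋ `B9.Ineq342_346_347`) wants the (3.42) clauses over the abstract quantities e_n with ONE pair (B₀, δ₀).  §4 types the co-reading `CoRealizes` (e_n(U,λ,y) is below every common bound of |(A(ev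 λ))(x)| over the block of y — print (3.39)/(3.42): e_n IS that sup — with ev λ block-supported and |ev λ| ≦ |λ|; OURS, a hypothesis schema like r1-g11's `Realizes`, nothing asserted), names the n-th (3.42) clause `Clause342` (`ineq342_346_347_iff` : `B9.Ineq342_346_347` ↔ (∀ n, Clause342 n) ∧ (3.46) ∧ (3.47), by `Iff.rfl`), and proves: majorant + co-reading ⇒ clause (`clause342_of_hasMajorantHom`, literal lineage shapes `clause342_e0_of_hasMajorant`, `clause342_e1/e2/e3_of_hasMajorantHom`), the merge of rates/constants (`clause342_mono`: C ≦ B₀, δ₀ ≦ δ′, d ≧ 0), the four clauses ⇒ ∀ n (`clause342_all`), and the assembly of `B9.Ineq342_346_347` with (3.46), (3.47) DISPLAYED as hypotheses (`ineq342_346_347_of_clauses`) — so the lineage now sits as a theorem-path between two typed cell nodes: `B9.Cor36Printed` ⟶ h342_* ⟶ (Thm 3.7 glue) ⟶ the (3.42) part of `B9.Ineq342_346_347` for G′(U), the L² / weighted parts (3.46)/(3.47) and the Hölder block (3.43)–(3.45) remaining hypotheses (print proves them by the same expansion, p. 409: "satisfy all the inequalities of Theorems 3.1–3.3"; not typed in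 this lineage).

v3 (APPEND-ONLY §5, journal claim HOM-342-RD-V3): `ExactReading` = `Realizes` ∧ `CoRealizes` as the two halves of "e_n IS the printed sup over the block, over a full block-supported evaluation" (`ExactReading.realizes`, `ExactReading.coRealizes`; neither half alone pins e_n), the per-clause form `hasMajorantHom_of_clause342`, and the CAPSTONE `clause342_iff_hasMajorantHom`: under the exact reading, the n-th inequality (3.42) as typed over b09's abstract carrier ⟺ the [4]-(2.51) majorant `maj342 g n B₀ δ₀` of the model operator (pv08's class).

v4 (APPEND-ONLY §6, journal claim HOM-342-RD-V4; answers the non-blocking remark R1 of the v1 cross-read by pv23-g6): the ∃(a₁, M₁, B₀, δ₀) of §3 pulled OUTSIDE the choice of the model lattices (`hasMajorantHom_of_cor36_joint`, `hasMajorantHom_of_thm31_joint`), and the four inputs h342_1…h342_4 delivered AT ONCE with one (B₀, δ₀) in their literal shapes (`h342_of_cor36_joint`).  (v4 first landed as p184355 = f2d96e6e9205; the earlier v3 proposal p184199, delayed in the verify lane, was applied afterwards (e822c8c37ac1) and reverted the file to v3; this text re-lands v4 unchanged — APPEND-ONLY over v3.)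

NOT ASSERTED (ABSOLUTE RULE): Theorem 3.1, Corollary 3.6, (3.42) — they enter as the hypotheses `B9.Ineq342_346_347 …`,
`B9.Cor36Printed …`, `B9.Thm31Printed …` (typed printed statements; their status is the cell's record on B9); no
operator is asserted to be realized by any kernel family (`Realizes` is a hypothesis); 0 ≦ L^jη (`hlen`) is a
hypothesis on the geometry; `CoRealizes` instances and 0 ≦ d, 0 ≦ |λ| likewise (v2); `ExactReading` instances likewise (v3).  Mathlib: `LinearMap.toMatrix'`, `LinearMap.toMatrix'_mulVec`.  Value: kernel-checked
bookkeeping (one DAG edge between two existing typings), NOT summit progress.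
-/

namespace Literature.MathematicalPhysics.QuantumFieldTheory.Balaban1983to89.B9Thm37GlueCor36

open Literature.MathematicalPhysics.QuantumFieldTheory.Balaban1983to89
open Finset B6RandomWalk B6RandomWalkHom B9Thm34Ext B9SectCDiffEstimate B9SectCDiffDict

/-! ## §1 Matrix block majorants (`BlkMaj`) versus operator majorants (`HasMajorantHom`) -/

section MatrixForm

variable {G : B6.Geometry} {u v : Type} [Fintype v] [DecidableEq v]

/-- The entries of the representing matrix reproduce the operator: Σ_{x′} (toMatrix′ A)(x,x′)μ(x′) = (Aμ)(x).
[folklore] -/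
theorem sum_toMatrix'_mul (A : (v → ℝ) →ₗ[ℝ] (u → ℝ)) (μ : v → ℝ) (x : u) :
    ∑ x', LinearMap.toMatrix' A x x' * μ x' = A μ x := by
  have h := congrFun (LinearMap.toMatrix'_mulVec A μ) x
  simpa [Matrix.mulVec, dotProduct] using h

/-- **Matrix block majorant ⇒ operator majorant** ([4] (2.51) shape *"|(Tλ)(v)| ≦ K(y,y′)|λ|, v in the block of y,
supp λ ⊂ Δ(y′)"*): if the representing matrix of A : (functions on v) → (functions on u) has block row sums
Σ_{x′ ∈ block y′}|A(x,x′)| ≦ K(block of x, y′) (`BlkMaj`, r1's class), then A has the majorant K in the sense of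
`HasMajorantHom` (pv08's class) — |(Aμ)(x)| ≦ Σ_{x′ ∈ block y′}|A(x,x′)|·B for μ vanishing off the block of y′ with
|μ| ≦ B. [cite: Balaban1984PropagatorsII, (2.51) p.232; Balaban1985BackgroundPropagators, (3.42) p.397] -/
theorem hasMajorantHom_of_blkMaj [DecidableEq G.Site] {bu : u → G.Site} {bv : v → G.Site}
    {A : (v → ℝ) →ₗ[ℝ] (u → ℝ)} {K : G.Site → G.Site → ℝ} (h : BlkMaj bu bv (LinearMap.toMatrix' A) K) :
    HasMajorantHom bv bu A K := by
  intro y' μ B hμ x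
  rw [← sum_toMatrix'_mul A μ x]
  have hsplit : ∑ x', LinearMap.toMatrix' A x x' * μ x' =
      ∑ x' ∈ univ.filter (fun x' => bv x' = y'), LinearMap.toMatrix' A x x' * μ x' := by
    rw [Finset.sum_filter]
    refine Finset.sum_congr rfl fun x' _ => ?_
    split_ifs with hx'
    · rfl
    · rw [hμ.off x' hx', mul_zero]
  rw [hsplit]
  calc |∑ x' ∈ univ.filter (fun x' => bv x' = y'), LinearMap.toMatrix' A x x' * μ x'|
      ≤ ∑ x' ∈ univ.filter (fun x' => bv x' = y'), |LinearMap.toMatrix' A x x' * μ x'| :=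
        Finset.abs_sum_le_sum_abs _ _
    _ ≤ ∑ x' ∈ univ.filter (fun x' => bv x' = y'), |LinearMap.toMatrix' A x x'| * B := by
        refine Finset.sum_le_sum fun x' hx' => ?_
        rw [abs_mul]
        exact mul_le_mul_of_nonneg_left (hμ.bound x' (Finset.mem_filter.mp hx').2) (abs_nonneg _)
    _ = (∑ x' ∈ univ.filter (fun x' => bv x' = y'), |LinearMap.toMatrix' A x x'|) * B := by
        rw [Finset.sum_mul]
    _ ≤ K (bu x) y' * B := mul_le_mul_of_nonneg_right (h.le x y') hμ.nonneg

/-- The one-lattice case of `hasMajorantHom_of_blkMaj` (`HasMajorant`). [folklore] -/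
theorem hasMajorant_of_blkMaj [DecidableEq G.Site] {bu : v → G.Site} {A : Module.End ℝ (v → ℝ)}
    {K : G.Site → G.Site → ℝ} (h : BlkMaj bu bu (LinearMap.toMatrix' A) K) : HasMajorant bu A K :=
  (hasMajorantHom_iff bu A K).1 (hasMajorantHom_of_blkMaj h)

/-- **Operator majorant ⇒ matrix block majorant** (the converse reading, for a nonnegative kernel): test
`HasMajorantHom` with the sources of sup ≦ 1 on one block (`BlkMaj.of_opBound`). [folklore] -/
theorem blkMaj_of_hasMajorantHom [DecidableEq G.Site] {bu : u → G.Site} {bv : v → G.Site}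
    {A : (v → ℝ) →ₗ[ℝ] (u → ℝ)} {K : G.Site → G.Site → ℝ} (hK : ∀ a b, 0 ≤ K a b)
    (h : HasMajorantHom bv bu A K) : BlkMaj bu bv (LinearMap.toMatrix' A) K :=
  BlkMaj.of_opBound hK fun x J f h1 h2 => by
    rw [sum_toMatrix'_mul A f x]
    have hf : BlockSupp bv f J 1 := ⟨zero_le_one, fun x' _ => h2 x', h1⟩
    simpa using h J f 1 hf x

end MatrixForm

/-! ## §2 (3.42) as typed (`B9.Ineq342_346_347`) ⇒ the [4]-(2.51) majorants of the glue lineage -/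

section Ineq342

variable {g : B9.Geometry} [Fintype g.Site] [DecidableEq g.Site] {R : ℝ} {H : Prop} {B : B9.Backgrounds}
variable {u v : Type} [Fintype v] [DecidableEq v]

omit [Fintype g.Site] [DecidableEq g.Site] in
/-- The (3.42) majorant at entry 0: B₀(L^jη)²e^{−δ₀d(y,y′)} (the shape of `h342_1`). [cite: Balaban1985BackgroundPropagators, (3.42) p.397] -/
theorem maj342_zero (B₀ δ₀ : ℝ) :
    maj342 g 0 B₀ δ₀ = fun a b => B₀ * g.len a ^ 2 * Real.exp (-(δ₀ * g.dist a b)) := by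
  funext a b; simp [maj342, B9.pref4]

omit [Fintype g.Site] [DecidableEq g.Site] in
/-- entry 1: B₀(L^jη)e^{−δ₀d(y,y′)} (the shape of `h342_2`). [cite: Balaban1985BackgroundPropagators, (3.42) p.397] -/
theorem maj342_one (B₀ δ₀ : ℝ) :
    maj342 g 1 B₀ δ₀ = fun a b => B₀ * g.len a * Real.exp (-(δ₀ * g.dist a b)) := by
  funext a b; simp [maj342, B9.pref4]

omit [Fintype g.Site] [DecidableEq g.Site] in
/-- entry 2: B₀(L^jη)e^{−δ₀d(y,y′)} (the shape of `h342_3`). [cite: Balaban1985BackgroundPropagators, (3.42) p.397] -/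
theorem maj342_two (B₀ δ₀ : ℝ) :
    maj342 g 2 B₀ δ₀ = fun a b => B₀ * g.len a * Real.exp (-(δ₀ * g.dist a b)) := by
  funext a b; simp [maj342, B9.pref4]

omit [Fintype g.Site] [DecidableEq g.Site] in
/-- entry 3: B₀e^{−δ₀d(y,y′)} (the shape of `h342_4`). [cite: Balaban1985BackgroundPropagators, (3.42) p.397] -/
theorem maj342_three (B₀ δ₀ : ℝ) :
    maj342 g 3 B₀ δ₀ = fun a b => B₀ * Real.exp (-(δ₀ * g.dist a b)) := by
  funext a b; simp [maj342, B9.pref4]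

/-- **(3.42) AS TYPED ⇒ the [4]-(2.51) majorant of a realized operator.**  From the first conjunct of
`B9.Ineq342_346_347 K B₀ δ₀ U` (*"≦ B₀[(L^jη)², L^jη, L^jη, 1]e^{−δ₀d(y,y′)}|λ| for x ∈ Δ(y), y ∈ Λ_j, supp λ ⊂ Δ(y′)"*)
and a realization of the linear map A (sources on the lattice v, values on the lattice u, block maps `bv`, `bu` to
𝔅) by the n-th observation quantity of K at U (`Realizes`, r1-g11's hypothesis structure, on the representing
matrix), A has the majorant `maj342 g n B₀ δ₀` in the sense of `HasMajorantHom` over the transported geometry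
`toB6 g R H` (composition of `blkMaj_of_ineq342` with §1). [cite: Balaban1985BackgroundPropagators, (3.42) p.397] -/
theorem hasMajorantHom_of_ineq342 {K : B9.KernelFamily g B} {B₀ δ₀ : ℝ} {U : B.Cfg}
    (hI : B9.Ineq342_346_347 K B₀ δ₀ U) {n : Fin 4} {bu : u → g.Site} {bv : v → g.Site}
    {A : (v → ℝ) →ₗ[ℝ] (u → ℝ)} (hR : Realizes K n U bu bv (LinearMap.toMatrix' A)) (hB₀ : 0 ≤ B₀)
    (hlen : ∀ y, 0 ≤ g.len y) :
    HasMajorantHom (g := toB6 g R H) bv bu A (maj342 g n B₀ δ₀) :=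
  @hasMajorantHom_of_blkMaj (toB6 g R H) u v _ _ (inferInstanceAs (DecidableEq g.Site)) bu bv A _
    (blkMaj_of_ineq342 hI hR hB₀ hlen)

/-- **Entry 0 of (3.42) in the shape of `h342_1`** (|(G′λ)(x)| ≦ B₀(L^jη)²e^{−δ₀d(y,y′)}|λ|): for an operator A on
one lattice realized by the quantity e₀. [cite: Balaban1985BackgroundPropagators, (3.42) p.397] -/
theorem hasMajorant_e0_of_ineq342 {K : B9.KernelFamily g B} {B₀ δ₀ : ℝ} {U : B.Cfg}
    (hI : B9.Ineq342_346_347 K B₀ δ₀ U) {blk : v → g.Site} {A : Module.End ℝ (v → ℝ)}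
    (hR : Realizes K 0 U blk blk (LinearMap.toMatrix' A)) (hB₀ : 0 ≤ B₀) (hlen : ∀ y, 0 ≤ g.len y) :
    HasMajorant (g := toB6 g R H) blk A (fun a b => B₀ * g.len a ^ 2 * Real.exp (-(δ₀ * g.dist a b))) := by
  have h := hasMajorantHom_of_ineq342 (R := R) (H := H) hI hR hB₀ hlen
  rw [maj342_zero] at h
  exact h

/-- **Entry 1 of (3.42) in the shape of `h342_2`** (|(∇_U G′λ)(b)| ≦ B₀(L^jη)e^{−δ₀d(y,y′)}|λ|): A from site
functions (lattice v) to bond functions (lattice u), realized by e₁. [cite: Balaban1985BackgroundPropagators, (3.42) p.397] -/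
theorem hasMajorantHom_e1_of_ineq342 {K : B9.KernelFamily g B} {B₀ δ₀ : ℝ} {U : B.Cfg}
    (hI : B9.Ineq342_346_347 K B₀ δ₀ U) {bu : u → g.Site} {bv : v → g.Site} {A : (v → ℝ) →ₗ[ℝ] (u → ℝ)}
    (hR : Realizes K 1 U bu bv (LinearMap.toMatrix' A)) (hB₀ : 0 ≤ B₀) (hlen : ∀ y, 0 ≤ g.len y) :
    HasMajorantHom (g := toB6 g R H) bv bu A (fun a b => B₀ * g.len a * Real.exp (-(δ₀ * g.dist a b))) := by
  have h := hasMajorantHom_of_ineq342 (R := R) (H := H) hI hR hB₀ hlen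
  rw [maj342_one] at h
  exact h

/-- **Entry 2 of (3.42) in the shape of `h342_3`** (|(G′∇*_U λ)(x)| ≦ B₀(L^jη)e^{−δ₀d(y,y′)}|λ|): A from bond
functions (lattice v) to site functions (lattice u), realized by e₂. [cite: Balaban1985BackgroundPropagators, (3.42) p.397] -/
theorem hasMajorantHom_e2_of_ineq342 {K : B9.KernelFamily g B} {B₀ δ₀ : ℝ} {U : B.Cfg}
    (hI : B9.Ineq342_346_347 K B₀ δ₀ U) {bu : u → g.Site} {bv : v → g.Site} {A : (v → ℝ) →ₗ[ℝ] (u → ℝ)}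
    (hR : Realizes K 2 U bu bv (LinearMap.toMatrix' A)) (hB₀ : 0 ≤ B₀) (hlen : ∀ y, 0 ≤ g.len y) :
    HasMajorantHom (g := toB6 g R H) bv bu A (fun a b => B₀ * g.len a * Real.exp (-(δ₀ * g.dist a b))) := by
  have h := hasMajorantHom_of_ineq342 (R := R) (H := H) hI hR hB₀ hlen
  rw [maj342_two] at h
  exact h

/-- **Entry 3 of (3.42) in the shape of `h342_4`** (|(Δ_U G′λ)(x)| ≦ B₀e^{−δ₀d(y,y′)}|λ|), realized by e₃.
[cite: Balaban1985BackgroundPropagators, (3.42) p.397] -/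
theorem hasMajorantHom_e3_of_ineq342 {K : B9.KernelFamily g B} {B₀ δ₀ : ℝ} {U : B.Cfg}
    (hI : B9.Ineq342_346_347 K B₀ δ₀ U) {bu : u → g.Site} {bv : v → g.Site} {A : (v → ℝ) →ₗ[ℝ] (u → ℝ)}
    (hR : Realizes K 3 U bu bv (LinearMap.toMatrix' A)) (hB₀ : 0 ≤ B₀) (hlen : ∀ y, 0 ≤ g.len y) :
    HasMajorantHom (g := toB6 g R H) bv bu A (fun a b => B₀ * Real.exp (-(δ₀ * g.dist a b))) := by
  have h := hasMajorantHom_of_ineq342 (R := R) (H := H) hI hR hB₀ hlen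
  rw [maj342_three] at h
  exact h

/-! ## §3 Corollary 3.6 / Theorem 3.1 as typed ⇒ the majorants for every member of the family -/

/-- **Corollary 3.6 AS TYPED ⇒ the `h342_*` inputs of the glue lineage, with the printed provisos displayed.**
For a family (index I: the cubes □ with their sequences {Ω_n(□)}, p. 409) on ONE geometry g and background class B,
`B9.Cor36Printed` yields constants a₁, M₁, B₀, δ₀ > 0 such that for every member in a cube of the class of (3.35)
(`InCube i`), M ≧ M₁, 0 < α₀ with O(1)Mα₀ ≦ a₁, and every U satisfying (3.35), each operator realized by the n-th
quantity of the member's G′-family has the (3.42) majorant `maj342 g n B₀ δ₀` ([4] (2.51) shape).  Corollary 3.6 is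
NOT asserted (hypothesis `h36`). [cite: Balaban1985BackgroundPropagators, Cor. 3.6 p.408 + p.409] -/
theorem hasMajorantHom_of_cor36 {I : Type} {d : ℕ} {c35 : ℝ} {InCube : I → Prop}
    {Gp GA : I → B9.KernelFamily g B} {Cinv : I → B9.SiteKernel g B}
    (h36 : B9.Cor36Printed d c35 (fun _ : I => g) (fun _ : I => B) InCube Gp GA Cinv)
    (hlen : ∀ y, 0 ≤ g.len y) (bu : u → g.Site) (bv : v → g.Site) :
    ∃ a₁ M₁ B₀ δ₀ : ℝ, 0 < a₁ ∧ 0 < M₁ ∧ 0 < B₀ ∧ 0 < δ₀ ∧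
      ∀ i : I, InCube i → M₁ ≤ g.M → ∀ α₀ : ℝ, 0 < α₀ → c35 * g.M * α₀ ≤ a₁ →
        ∀ U : B.Cfg, B.Reg335 c35 α₀ U → ∀ (n : Fin 4) (A : (v → ℝ) →ₗ[ℝ] (u → ℝ)),
          Realizes (Gp i) n U bu bv (LinearMap.toMatrix' A) →
            HasMajorantHom (g := toB6 g R H) bv bu A (maj342 g n B₀ δ₀) := by
  obtain ⟨a₁, M₁, B₀, δ₀, Bβ, Bε, Bεβ, B₁, δ₁, ha₁, hM₁, hB₀, hδ₀, _hB₁, _hδ₁, hall⟩ := h36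
  refine ⟨a₁, M₁, B₀, δ₀, ha₁, hM₁, hB₀, hδ₀, ?_⟩
  intro i hi hM α₀ hα hsmall U hU n A hR
  have hAt := hall i hi hM α₀ hα hsmall U hU
  exact hasMajorantHom_of_ineq342 hAt.1.1 hR hB₀.le hlen

/-- **Theorem 3.1 AS TYPED ⇒ the (3.42) majorants of the realized operators**, with the printed provisos M ≧ M₁,
Mα₀ ≦ a₀, (3.35) displayed (family on one geometry; Theorem 3.1 NOT asserted: hypothesis `h31`).
[cite: Balaban1985BackgroundPropagators, Thm 3.1 (3.42) p.397] -/
theorem hasMajorantHom_of_thm31 {I : Type} {c35 : ℝ} {Gp : I → B9.KernelFamily g B}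
    (h31 : B9.Thm31Printed c35 (fun _ : I => g) (fun _ : I => B) Gp)
    (hlen : ∀ y, 0 ≤ g.len y) (bu : u → g.Site) (bv : v → g.Site) :
    ∃ M₁ δ₀ a₀ B₀ : ℝ, 0 < M₁ ∧ 0 < δ₀ ∧ 0 < a₀ ∧ 0 < B₀ ∧
      ∀ i : I, M₁ ≤ g.M → ∀ α₀ : ℝ, 0 < α₀ → g.M * α₀ ≤ a₀ →
        ∀ U : B.Cfg, B.Reg335 c35 α₀ U → ∀ (n : Fin 4) (A : (v → ℝ) →ₗ[ℝ] (u → ℝ)),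
          Realizes (Gp i) n U bu bv (LinearMap.toMatrix' A) →
            HasMajorantHom (g := toB6 g R H) bv bu A (maj342 g n B₀ δ₀) := by
  obtain ⟨M₁, δ₀, a₀, B₀, Bβ, Bε, Bεβ, hM₁, hδ₀, ha₀, hB₀, hall⟩ := h31
  refine ⟨M₁, δ₀, a₀, B₀, hM₁, hδ₀, ha₀, hB₀, ?_⟩
  intro i hM α₀ hα hsmall U hU n A hR
  have hAt := hall i hM α₀ hα hsmall U hU
  exact hasMajorantHom_of_ineq342 hAt.1 hR hB₀.le hlen

end Ineq342

/-! ## §4 (v2) The converse reading: [4]-(2.51) majorants ⇒ the (3.42) clauses AS TYPED -/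

section CoReading

variable {g : B9.Geometry} [Fintype g.Site] {R : ℝ} {H : Prop} {B : B9.Backgrounds}
variable {u v : Type}

/-- **CO-READING of the n-th observation quantity by a model operator** (the direction converse to r1-g11's
`Realizes`).  Print, (3.39) p. 397: *"|A| = max_μ sup_x |A_μ(x)|"*, and (3.42): the bounded quantity is the sup over
x ∈ Δ(y) of the n-th entry |(G′(U)λ)(x)|, … for supp λ ⊂ Δ(y′).  Typed: `ev λ` evaluates the abstract argument λ
(`g.Loc`) as a function on the model lattice v; supp λ ⊂ Δ(y′) ⇒ `ev λ` vanishes off the block of y′ (`off`);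
|ev λ| ≦ |λ| pointwise (`bound`), |λ| ≧ 0 (`norm_nonneg`); and e_n(U, λ, y) is BELOW every nonnegative common bound
of |(A(ev λ))(x)| over the block of y (`obs` — e_n is that sup; empty blocks included).  OURS (typing): a hypothesis
schema on how a model instantiates `B9.Geometry.Loc` / `B9.KernelFamily.e`; nothing is asserted.
[cite: Balaban1985BackgroundPropagators, (3.39) + (3.42) p.397] -/
structure CoRealizes (K : B9.KernelFamily g B) (n : Fin 4) (U : B.Cfg) (bu : u → g.Site) (bv : v → g.Site)
    (ev : g.Loc → v → ℝ) (A : (v → ℝ) →ₗ[ℝ] (u → ℝ)) : Prop where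
  off : ∀ (lam : g.Loc) (y' : g.Site), g.suppIn lam y' → ∀ x', bv x' ≠ y' → ev lam x' = 0
  bound : ∀ (lam : g.Loc) (x' : v), |ev lam x'| ≤ g.supNorm lam
  norm_nonneg : ∀ lam : g.Loc, 0 ≤ g.supNorm lam
  obs : ∀ (lam : g.Loc) (y : g.Site) (c : ℝ), 0 ≤ c → (∀ x, bu x = y → |A (ev lam) x| ≤ c) → K.e n U lam y ≤ c

/-- **The n-th clause of (3.42) AS TYPED** (the n-th instance of the first conjunct of `B9.Ineq342_346_347`):
e_n(U, λ, y) ≦ B₀[(L^jη)², L^jη, L^jη, 1]_n e^{−δ₀d(y,y′)}|λ| for supp λ ⊂ Δ(y′).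
[cite: Balaban1985BackgroundPropagators, (3.42) p.397] -/
def Clause342 (K : B9.KernelFamily g B) (n : Fin 4) (B₀ δ₀ : ℝ) (U : B.Cfg) : Prop :=
  ∀ (lam : g.Loc) (y y' : g.Site), g.suppIn lam y' →
    K.e n U lam y ≤ B₀ * B9.pref4 (g.len y) n * Real.exp (-(δ₀ * g.dist y y')) * g.supNorm lam

omit [Fintype g.Site] in
/-- `B9.Ineq342_346_347` is, by `Iff.rfl`, (∀ n, the n-th (3.42) clause) ∧ (3.46) ∧ (3.47).
[cite: Balaban1985BackgroundPropagators, (3.42) + (3.46) + (3.47) pp.397–398] -/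
theorem ineq342_346_347_iff (K : B9.KernelFamily g B) (B₀ δ₀ : ℝ) (U : B.Cfg) :
    B9.Ineq342_346_347 K B₀ δ₀ U ↔
      (∀ n : Fin 4, Clause342 K n B₀ δ₀ U) ∧
      (∀ (n : Fin 6) (lam : g.Loc) (h : g.Cut) (y y' : g.Site), g.cutIn h y → g.suppIn lam y' →
          K.l2 n U lam h ≤ B₀ * B9.pref6 (g.len y) n * g.cutSup h * Real.exp (-(δ₀ * g.dist y y')) *
            g.l2Norm lam) ∧
      (∀ (n : Fin 4) (lam : g.Loc) (γ : ℝ), -4 ≤ γ → γ ≤ 4 → K.glob n U lam γ ≤ B₀ * g.wNorm γ lam) :=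
  Iff.rfl

omit [Fintype g.Site] in
/-- **Assembly of (3.42) + (3.46) + (3.47) AS TYPED from the four (3.42) clauses, with the L² part (3.46) and the
weighted part (3.47) DISPLAYED as hypotheses** (not produced by the sup-majorant lineage).
[cite: Balaban1985BackgroundPropagators, (3.42) + (3.46) + (3.47) pp.397–398] -/
theorem ineq342_346_347_of_clauses {K : B9.KernelFamily g B} {B₀ δ₀ : ℝ} {U : B.Cfg}
    (h342 : ∀ n : Fin 4, Clause342 K n B₀ δ₀ U)
    (h346 : ∀ (n : Fin 6) (lam : g.Loc) (h : g.Cut) (y y' : g.Site), g.cutIn h y → g.suppIn lam y' →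
        K.l2 n U lam h ≤ B₀ * B9.pref6 (g.len y) n * g.cutSup h * Real.exp (-(δ₀ * g.dist y y')) *
          g.l2Norm lam)
    (h347 : ∀ (n : Fin 4) (lam : g.Loc) (γ : ℝ), -4 ≤ γ → γ ≤ 4 → K.glob n U lam γ ≤ B₀ * g.wNorm γ lam) :
    B9.Ineq342_346_347 K B₀ δ₀ U :=
  ⟨h342, h346, h347⟩

omit [Fintype g.Site] in
/-- The four entry clauses n = 0, 1, 2, 3 give the clause for every n : Fin 4. [folklore] -/
theorem clause342_all {K : B9.KernelFamily g B} {B₀ δ₀ : ℝ} {U : B.Cfg} (h0 : Clause342 K 0 B₀ δ₀ U)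
    (h1 : Clause342 K 1 B₀ δ₀ U) (h2 : Clause342 K 2 B₀ δ₀ U) (h3 : Clause342 K 3 B₀ δ₀ U) :
    ∀ n : Fin 4, Clause342 K n B₀ δ₀ U := by
  intro n
  fin_cases n
  · exact h0
  · exact h1
  · exact h2
  · exact h3

omit [Fintype g.Site] in
/-- **Merging rates and constants**: a clause with constant C ≦ B₀ (C ≧ 0) and rate δ′ ≧ δ₀ implies the clause with
(B₀, δ₀), for d ≧ 0 and L^jη ≧ 0 (used to bring the lineage's entries, whose rates are (1−α)δ₀ resp. (1−2α)δ₀ and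
whose constants differ, to one pair (B₀, δ₀) as Theorem 3.1 is typed). [folklore] -/
theorem clause342_mono {K : B9.KernelFamily g B} {n : Fin 4} {C δ' B₀ δ₀ : ℝ} {U : B.Cfg}
    (h : Clause342 K n C δ' U) (hC : 0 ≤ C) (hCB : C ≤ B₀) (hδ : δ₀ ≤ δ') (hdist : ∀ a b, 0 ≤ g.dist a b)
    (hlen : ∀ y, 0 ≤ g.len y) (hnorm : ∀ lam, 0 ≤ g.supNorm lam) : Clause342 K n B₀ δ₀ U := by
  intro lam y y' hs
  refine (h lam y y' hs).trans ?_
  have hp : 0 ≤ B9.pref4 (g.len y) n := pref4_nonneg (hlen y) n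
  have hexp : Real.exp (-(δ' * g.dist y y')) ≤ Real.exp (-(δ₀ * g.dist y y')) :=
    Real.exp_le_exp.2 (neg_le_neg (mul_le_mul_of_nonneg_right hδ (hdist y y')))
  have h1 : C * B9.pref4 (g.len y) n * Real.exp (-(δ' * g.dist y y')) ≤
      B₀ * B9.pref4 (g.len y) n * Real.exp (-(δ₀ * g.dist y y')) :=
    mul_le_mul (mul_le_mul_of_nonneg_right hCB hp) hexp (Real.exp_pos _).le
      (mul_nonneg (hC.trans hCB) hp)
  exact mul_le_mul_of_nonneg_right h1 (hnorm lam)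

/-- **[4]-(2.51) majorant + co-reading ⇒ the abstract bound**: if A has the majorant K′ ≧ 0 (`HasMajorantHom` over
`toB6 g R H`) and e_n is co-read by A, then e_n(U, λ, y) ≦ K′(y, y′)|λ| for supp λ ⊂ Δ(y′).
[cite: Balaban1985BackgroundPropagators, (3.39) + (3.42) p.397; Balaban1984PropagatorsII, (2.51) p.232] -/
theorem le_of_hasMajorantHom_of_coRealizes {K : B9.KernelFamily g B} {n : Fin 4} {U : B.Cfg}
    {bu : u → g.Site} {bv : v → g.Site} {ev : g.Loc → v → ℝ} {A : (v → ℝ) →ₗ[ℝ] (u → ℝ)}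
    (hC : CoRealizes K n U bu bv ev A) {K' : g.Site → g.Site → ℝ} (hK' : ∀ a b, 0 ≤ K' a b)
    (hA : HasMajorantHom (g := toB6 g R H) bv bu A K') :
    ∀ (lam : g.Loc) (y y' : g.Site), g.suppIn lam y' → K.e n U lam y ≤ K' y y' * g.supNorm lam := by
  intro lam y y' hs
  refine hC.obs lam y _ (mul_nonneg (hK' y y') (hC.norm_nonneg lam)) fun x hx => ?_
  have hμ : BlockSupp (g := toB6 g R H) bv (ev lam) y' (g.supNorm lam) :=
    ⟨hC.norm_nonneg lam, fun x' _ => hC.bound lam x', hC.off lam y' hs⟩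
  have hb := hA y' (ev lam) (g.supNorm lam) hμ x
  rw [hx] at hb
  exact hb

/-- **Majorant `maj342 g n B₀ δ₀` + co-reading ⇒ the n-th (3.42) clause AS TYPED.**
[cite: Balaban1985BackgroundPropagators, (3.42) p.397] -/
theorem clause342_of_hasMajorantHom {K : B9.KernelFamily g B} {n : Fin 4} {U : B.Cfg}
    {bu : u → g.Site} {bv : v → g.Site} {ev : g.Loc → v → ℝ} {A : (v → ℝ) →ₗ[ℝ] (u → ℝ)}
    (hC : CoRealizes K n U bu bv ev A) {B₀ δ₀ : ℝ}
    (hA : HasMajorantHom (g := toB6 g R H) bv bu A (maj342 g n B₀ δ₀)) (hB₀ : 0 ≤ B₀)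
    (hlen : ∀ y, 0 ≤ g.len y) : Clause342 K n B₀ δ₀ U :=
  fun lam y y' hs => le_of_hasMajorantHom_of_coRealizes hC (maj342_nonneg hB₀ hlen n δ₀) hA lam y y' hs

/-- **Entry 0 from the lineage's output shape** (`thm37_entry1_of_342_lattice_of_387_sz`: `HasMajorant blk G′
(fun a b => C * g.len a ^ 2 * exp (−(δ′ * g.dist a b)))`) ⇒ the 0-th (3.42) clause with (C, δ′).
[cite: Balaban1985BackgroundPropagators, (3.42) p.397] -/
theorem clause342_e0_of_hasMajorant {K : B9.KernelFamily g B} {U : B.Cfg}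
    {blk : v → g.Site} {ev : g.Loc → v → ℝ} {A : Module.End ℝ (v → ℝ)} (hC : CoRealizes K 0 U blk blk ev A)
    {C δ' : ℝ} (hA : HasMajorant (g := toB6 g R H) blk A (fun a b => C * g.len a ^ 2 * Real.exp (-(δ' * g.dist a b))))
    (hC0 : 0 ≤ C) (hlen : ∀ y, 0 ≤ g.len y) : Clause342 K 0 C δ' U := by
  have hA' : HasMajorantHom (g := toB6 g R H) blk blk A (maj342 g 0 C δ') := by
    rw [maj342_zero]; exact hA
  exact clause342_of_hasMajorantHom hC hA' hC0 hlen

/-- **Entry 1 from the lineage's output shape** (`thm37_entry2_…`: ∇G′ : sites → bonds, majorant C·L^jη·e^{−δ′d}).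
[cite: Balaban1985BackgroundPropagators, (3.42) p.397] -/
theorem clause342_e1_of_hasMajorantHom {K : B9.KernelFamily g B} {U : B.Cfg} {bu : u → g.Site}
    {bv : v → g.Site} {ev : g.Loc → v → ℝ} {A : (v → ℝ) →ₗ[ℝ] (u → ℝ)} (hC : CoRealizes K 1 U bu bv ev A)
    {C δ' : ℝ} (hA : HasMajorantHom (g := toB6 g R H) bv bu A (fun a b => C * g.len a * Real.exp (-(δ' * g.dist a b))))
    (hC0 : 0 ≤ C) (hlen : ∀ y, 0 ≤ g.len y) : Clause342 K 1 C δ' U := by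
  have hA' : HasMajorantHom (g := toB6 g R H) bv bu A (maj342 g 1 C δ') := by
    rw [maj342_one]; exact hA
  exact clause342_of_hasMajorantHom hC hA' hC0 hlen

/-- **Entry 2 from the lineage's output shape** (`thm37_entry3_…`: G′∇* : bonds → sites, majorant C·L^jη·e^{−δ′d}).
[cite: Balaban1985BackgroundPropagators, (3.42) p.397] -/
theorem clause342_e2_of_hasMajorantHom {K : B9.KernelFamily g B} {U : B.Cfg} {bu : u → g.Site}
    {bv : v → g.Site} {ev : g.Loc → v → ℝ} {A : (v → ℝ) →ₗ[ℝ] (u → ℝ)} (hC : CoRealizes K 2 U bu bv ev A)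
    {C δ' : ℝ} (hA : HasMajorantHom (g := toB6 g R H) bv bu A (fun a b => C * g.len a * Real.exp (-(δ' * g.dist a b))))
    (hC0 : 0 ≤ C) (hlen : ∀ y, 0 ≤ g.len y) : Clause342 K 2 C δ' U := by
  have hA' : HasMajorantHom (g := toB6 g R H) bv bu A (maj342 g 2 C δ') := by
    rw [maj342_two]; exact hA
  exact clause342_of_hasMajorantHom hC hA' hC0 hlen

/-- **Entry 3 from the lineage's output shape** (`thm37_entry4_…`: ΔG′, majorant C·e^{−δ′d}).
[cite: Balaban1985BackgroundPropagators, (3.42) p.397] -/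
theorem clause342_e3_of_hasMajorantHom {K : B9.KernelFamily g B} {U : B.Cfg} {bu : u → g.Site}
    {bv : v → g.Site} {ev : g.Loc → v → ℝ} {A : (v → ℝ) →ₗ[ℝ] (u → ℝ)} (hC : CoRealizes K 3 U bu bv ev A)
    {C δ' : ℝ} (hA : HasMajorantHom (g := toB6 g R H) bv bu A (fun a b => C * Real.exp (-(δ' * g.dist a b))))
    (hC0 : 0 ≤ C) (hlen : ∀ y, 0 ≤ g.len y) : Clause342 K 3 C δ' U := by
  have hA' : HasMajorantHom (g := toB6 g R H) bv bu A (maj342 g 3 C δ') := by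
    rw [maj342_three]; exact hA
  exact clause342_of_hasMajorantHom hC hA' hC0 hlen

end CoReading

/-! ## §5 (v3) The two readings together: "e_n IS the printed sup" ⇒ (3.42)-clause ⟺ [4]-(2.51) majorant -/

section ExactReading

variable {g : B9.Geometry} [Fintype g.Site] {R : ℝ} {H : Prop} {B : B9.Backgrounds}
variable {u v : Type}

/-- **EXACT READING** = r1-g11's `Realizes` and §4's `CoRealizes` as the two halves of ONE statement about a model:
the evaluation `ev` of the abstract arguments λ is block-supported and bounded by |λ| ≧ 0 (`off`, `bound`,
`norm_nonneg`) and FULL — every test function on the block of y′ with sup ≦ 1 is `ev λ` for some λ with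
supp λ ⊂ Δ(y′), |λ| ≦ 1 (`full`) — and e_n(U, λ, y) is EXACTLY the sup over the block of y of |(A(ev λ))(x)|: an upper
bound (`ub`) below every nonnegative common bound (`lub`).  Print (3.39)/(3.42) p. 397: the bounded quantities ARE
these sups.  OURS (typing; a hypothesis schema — it records what "the model instantiates `B9.KernelFamily.e n` by the
operator A" means; nothing asserted).  Neither half alone pins e_n (`CoRealizes` holds for e ≡ 0, `Realizes` for e
huge); together they do. [cite: Balaban1985BackgroundPropagators, (3.39) + (3.42) p.397] -/
structure ExactReading (K : B9.KernelFamily g B) (n : Fin 4) (U : B.Cfg) (bu : u → g.Site) (bv : v → g.Site)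
    (ev : g.Loc → v → ℝ) (A : (v → ℝ) →ₗ[ℝ] (u → ℝ)) : Prop where
  off : ∀ (lam : g.Loc) (y' : g.Site), g.suppIn lam y' → ∀ x', bv x' ≠ y' → ev lam x' = 0
  bound : ∀ (lam : g.Loc) (x' : v), |ev lam x'| ≤ g.supNorm lam
  norm_nonneg : ∀ lam : g.Loc, 0 ≤ g.supNorm lam
  ub : ∀ (lam : g.Loc) (x : u), |A (ev lam) x| ≤ K.e n U lam (bu x)
  lub : ∀ (lam : g.Loc) (y : g.Site) (c : ℝ), 0 ≤ c → (∀ x, bu x = y → |A (ev lam) x| ≤ c) → K.e n U lam y ≤ c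
  full : ∀ (y' : g.Site) (f : v → ℝ), (∀ x', bv x' ≠ y' → f x' = 0) → (∀ x', |f x'| ≤ 1) →
    ∃ lam : g.Loc, g.suppIn lam y' ∧ g.supNorm lam ≤ 1 ∧ ev lam = f

omit [Fintype g.Site] in
/-- The exact reading contains the co-reading (§4). [folklore] -/
theorem ExactReading.coRealizes {K : B9.KernelFamily g B} {n : Fin 4} {U : B.Cfg} {bu : u → g.Site}
    {bv : v → g.Site} {ev : g.Loc → v → ℝ} {A : (v → ℝ) →ₗ[ℝ] (u → ℝ)} (h : ExactReading K n U bu bv ev A) :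
    CoRealizes K n U bu bv ev A :=
  ⟨h.off, h.bound, h.norm_nonneg, h.lub⟩

omit [Fintype g.Site] in
/-- The exact reading contains r1-g11's reading `Realizes` of the representing matrix. [folklore] -/
theorem ExactReading.realizes [Fintype v] [DecidableEq v] {K : B9.KernelFamily g B} {n : Fin 4} {U : B.Cfg}
    {bu : u → g.Site} {bv : v → g.Site} {ev : g.Loc → v → ℝ} {A : (v → ℝ) →ₗ[ℝ] (u → ℝ)}
    (h : ExactReading K n U bu bv ev A) : Realizes K n U bu bv (LinearMap.toMatrix' A) :=
  ⟨fun x y' f h1 h2 => by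
    obtain ⟨lam, hs, hn, hev⟩ := h.full y' f h1 h2
    refine ⟨lam, hs, hn, ?_⟩
    rw [sum_toMatrix'_mul, ← hev]
    exact h.ub lam x⟩

/-- **The n-th (3.42) clause AS TYPED ⇒ the [4]-(2.51) majorant**, per clause (r1-g11's `blkMaj_of_ineq342` needs the
whole first conjunct; this is its one-entry form composed with §1). [cite: Balaban1985BackgroundPropagators, (3.42) p.397] -/
theorem hasMajorantHom_of_clause342 [DecidableEq g.Site] [Fintype v] [DecidableEq v] {K : B9.KernelFamily g B}
    {n : Fin 4} {B₀ δ₀ : ℝ} {U : B.Cfg} (hcl : Clause342 K n B₀ δ₀ U) {bu : u → g.Site} {bv : v → g.Site}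
    {A : (v → ℝ) →ₗ[ℝ] (u → ℝ)} (hR : Realizes K n U bu bv (LinearMap.toMatrix' A)) (hB₀ : 0 ≤ B₀)
    (hlen : ∀ y, 0 ≤ g.len y) : HasMajorantHom (g := toB6 g R H) bv bu A (maj342 g n B₀ δ₀) := by
  have hb : BlkMaj bu bv (LinearMap.toMatrix' A) (maj342 g n B₀ δ₀) := by
    refine BlkMaj.of_opBound (maj342_nonneg hB₀ hlen n δ₀) fun x y' f hf1 hf2 => ?_
    obtain ⟨lam, hsupp, hnorm, hle⟩ := hR.rep x y' f hf1 hf2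
    have hnn : 0 ≤ maj342 g n B₀ δ₀ (bu x) y' := maj342_nonneg hB₀ hlen n δ₀ (bu x) y'
    calc |∑ x', LinearMap.toMatrix' A x x' * f x'| ≤ K.e n U lam (bu x) := hle
      _ ≤ maj342 g n B₀ δ₀ (bu x) y' * g.supNorm lam := hcl lam (bu x) y' hsupp
      _ ≤ maj342 g n B₀ δ₀ (bu x) y' * 1 := mul_le_mul_of_nonneg_left hnorm hnn
      _ = maj342 g n B₀ δ₀ (bu x) y' := mul_one _
  exact @hasMajorantHom_of_blkMaj (toB6 g R H) u v _ _ (inferInstanceAs (DecidableEq g.Site)) bu bv A _ hb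

/-- **CAPSTONE: under the exact reading, the n-th inequality (3.42) AS TYPED over the abstract carrier
(`Clause342`, b09's `B9.KernelFamily`) is EQUIVALENT to the [4]-(2.51) majorant of the model operator
(`HasMajorantHom … (maj342 g n B₀ δ₀)`, pv08's class)** — the two typings of (3.42) in the cell say the same thing.
[cite: Balaban1985BackgroundPropagators, (3.39) + (3.42) p.397; Balaban1984PropagatorsII, (2.51) p.232] -/
theorem clause342_iff_hasMajorantHom [DecidableEq g.Site] [Fintype v] [DecidableEq v] {K : B9.KernelFamily g B}
    {n : Fin 4} {U : B.Cfg} {bu : u → g.Site} {bv : v → g.Site} {ev : g.Loc → v → ℝ}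
    {A : (v → ℝ) →ₗ[ℝ] (u → ℝ)} (h : ExactReading K n U bu bv ev A) {B₀ δ₀ : ℝ} (hB₀ : 0 ≤ B₀)
    (hlen : ∀ y, 0 ≤ g.len y) :
    Clause342 K n B₀ δ₀ U ↔ HasMajorantHom (g := toB6 g R H) bv bu A (maj342 g n B₀ δ₀) :=
  ⟨fun hcl => hasMajorantHom_of_clause342 hcl h.realizes hB₀ hlen,
    fun hA => clause342_of_hasMajorantHom h.coRealizes hA hB₀ hlen⟩

end ExactReading

/-! ## §6 (v4) One pair (B₀, δ₀) for all model lattices (cross-read remark R1, pv23-g6) -/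

section Joint

variable {g : B9.Geometry} [Fintype g.Site] [DecidableEq g.Site] {R : ℝ} {H : Prop} {B : B9.Backgrounds}

/-- **Corollary 3.6 AS TYPED ⇒ ONE pair (B₀, δ₀) for all lattices, block maps, entries and realized operators** —
the ∃ of `hasMajorantHom_of_cor36` pulled OUTSIDE the choice of the model lattices (cross-read remark R1 on v1,
pv23-g6): the inputs h342_1, h342_2, h342_3, h342_4 of the glue lineage live on different lattices (sites × colours,
bonds × colours) and must carry the SAME constants, as print's Theorem 3.1 / Corollary 3.6 state them ("There exist
positive constants M₁, δ₀, a₀, B₀ dependent on d and L only", p. 397).  Corollary 3.6 NOT asserted (hypothesis `h36`).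
[cite: Balaban1985BackgroundPropagators, Thm 3.1 p.397, Cor. 3.6 p.408 + p.409] -/
theorem hasMajorantHom_of_cor36_joint {I : Type} {d : ℕ} {c35 : ℝ} {InCube : I → Prop}
    {Gp GA : I → B9.KernelFamily g B} {Cinv : I → B9.SiteKernel g B}
    (h36 : B9.Cor36Printed d c35 (fun _ : I => g) (fun _ : I => B) InCube Gp GA Cinv)
    (hlen : ∀ y, 0 ≤ g.len y) :
    ∃ a₁ M₁ B₀ δ₀ : ℝ, 0 < a₁ ∧ 0 < M₁ ∧ 0 < B₀ ∧ 0 < δ₀ ∧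
      ∀ i : I, InCube i → M₁ ≤ g.M → ∀ α₀ : ℝ, 0 < α₀ → c35 * g.M * α₀ ≤ a₁ →
        ∀ U : B.Cfg, B.Reg335 c35 α₀ U →
          ∀ (u v : Type) [Fintype v] [DecidableEq v] (bu : u → g.Site) (bv : v → g.Site) (n : Fin 4)
            (A : (v → ℝ) →ₗ[ℝ] (u → ℝ)), Realizes (Gp i) n U bu bv (LinearMap.toMatrix' A) →
              HasMajorantHom (g := toB6 g R H) bv bu A (maj342 g n B₀ δ₀) := by
  obtain ⟨a₁, M₁, B₀, δ₀, Bβ, Bε, Bεβ, B₁, δ₁, ha₁, hM₁, hB₀, hδ₀, _hB₁, _hδ₁, hall⟩ := h36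
  refine ⟨a₁, M₁, B₀, δ₀, ha₁, hM₁, hB₀, hδ₀, ?_⟩
  intro i hi hM α₀ hα hsmall U hU u v _ _ bu bv n A hR
  exact hasMajorantHom_of_ineq342 (hall i hi hM α₀ hα hsmall U hU).1.1 hR hB₀.le hlen

/-- **Theorem 3.1 AS TYPED ⇒ ONE pair (B₀, δ₀) for all model lattices** (the joint form of
`hasMajorantHom_of_thm31`; Theorem 3.1 NOT asserted: hypothesis `h31`).
[cite: Balaban1985BackgroundPropagators, Thm 3.1 (3.42) p.397] -/
theorem hasMajorantHom_of_thm31_joint {I : Type} {c35 : ℝ} {Gp : I → B9.KernelFamily g B}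
    (h31 : B9.Thm31Printed c35 (fun _ : I => g) (fun _ : I => B) Gp) (hlen : ∀ y, 0 ≤ g.len y) :
    ∃ M₁ δ₀ a₀ B₀ : ℝ, 0 < M₁ ∧ 0 < δ₀ ∧ 0 < a₀ ∧ 0 < B₀ ∧
      ∀ i : I, M₁ ≤ g.M → ∀ α₀ : ℝ, 0 < α₀ → g.M * α₀ ≤ a₀ →
        ∀ U : B.Cfg, B.Reg335 c35 α₀ U →
          ∀ (u v : Type) [Fintype v] [DecidableEq v] (bu : u → g.Site) (bv : v → g.Site) (n : Fin 4)
            (A : (v → ℝ) →ₗ[ℝ] (u → ℝ)), Realizes (Gp i) n U bu bv (LinearMap.toMatrix' A) →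
              HasMajorantHom (g := toB6 g R H) bv bu A (maj342 g n B₀ δ₀) := by
  obtain ⟨M₁, δ₀, a₀, B₀, Bβ, Bε, Bεβ, hM₁, hδ₀, ha₀, hB₀, hall⟩ := h31
  refine ⟨M₁, δ₀, a₀, B₀, hM₁, hδ₀, ha₀, hB₀, ?_⟩
  intro i hM α₀ hα hsmall U hU u v _ _ bu bv n A hR
  exact hasMajorantHom_of_ineq342 (hall i hM α₀ hα hsmall U hU).1 hR hB₀.le hlen

/-- **The four inputs h342_1 … h342_4 of the glue lineage AT ONCE, with one (B₀, δ₀), from Corollary 3.6 AS TYPED**: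
for a member i in a cube of the (3.35) class, M ≧ M₁, O(1)Mα₀ ≦ a₁, U regular, and the four operators G (sites),
DG (sites → bonds), GDt (bonds → sites), L (sites) realized by e₀, e₁, e₂, e₃ of the member's G′-family, the literal
shapes consumed by `thm37_entry*_of_342_lattice_of_387_sz`. [cite: Balaban1985BackgroundPropagators, (3.42) p.397, Cor. 3.6 p.408] -/
theorem h342_of_cor36_joint {I : Type} {d : ℕ} {c35 : ℝ} {InCube : I → Prop}
    {Gp GA : I → B9.KernelFamily g B} {Cinv : I → B9.SiteKernel g B}
    (h36 : B9.Cor36Printed d c35 (fun _ : I => g) (fun _ : I => B) InCube Gp GA Cinv)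
    (hlen : ∀ y, 0 ≤ g.len y) :
    ∃ a₁ M₁ B₀ δ₀ : ℝ, 0 < a₁ ∧ 0 < M₁ ∧ 0 < B₀ ∧ 0 < δ₀ ∧
      ∀ i : I, InCube i → M₁ ≤ g.M → ∀ α₀ : ℝ, 0 < α₀ → c35 * g.M * α₀ ≤ a₁ →
        ∀ U : B.Cfg, B.Reg335 c35 α₀ U →
          ∀ (s t : Type) [Fintype s] [DecidableEq s] [Fintype t] [DecidableEq t] (blk : s → g.Site)
            (blkY : t → g.Site) (G : Module.End ℝ (s → ℝ)) (DG : (s → ℝ) →ₗ[ℝ] (t → ℝ))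
            (GDt : (t → ℝ) →ₗ[ℝ] (s → ℝ)) (L : Module.End ℝ (s → ℝ)),
            Realizes (Gp i) 0 U blk blk (LinearMap.toMatrix' G) →
            Realizes (Gp i) 1 U blkY blk (LinearMap.toMatrix' DG) →
            Realizes (Gp i) 2 U blk blkY (LinearMap.toMatrix' GDt) →
            Realizes (Gp i) 3 U blk blk (LinearMap.toMatrix' L) →
              HasMajorant (g := toB6 g R H) blk G (fun a b => B₀ * g.len a ^ 2 * Real.exp (-(δ₀ * g.dist a b))) ∧
              HasMajorantHom (g := toB6 g R H) blk blkY DG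
                (fun a b => B₀ * g.len a * Real.exp (-(δ₀ * g.dist a b))) ∧
              HasMajorantHom (g := toB6 g R H) blkY blk GDt
                (fun a b => B₀ * g.len a * Real.exp (-(δ₀ * g.dist a b))) ∧
              HasMajorantHom (g := toB6 g R H) blk blk L (fun a b => B₀ * Real.exp (-(δ₀ * g.dist a b))) := by
  obtain ⟨a₁, M₁, B₀, δ₀, Bβ, Bε, Bεβ, B₁, δ₁, ha₁, hM₁, hB₀, hδ₀, _hB₁, _hδ₁, hall⟩ := h36
  refine ⟨a₁, M₁, B₀, δ₀, ha₁, hM₁, hB₀, hδ₀, ?_⟩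
  intro i hi hM α₀ hα hsmall U hU s t _ _ _ _ blk blkY G DG GDt L h0 h1 h2 h3
  have hI : B9.Ineq342_346_347 (Gp i) B₀ δ₀ U := (hall i hi hM α₀ hα hsmall U hU).1.1
  exact ⟨hasMajorant_e0_of_ineq342 hI h0 hB₀.le hlen, hasMajorantHom_e1_of_ineq342 hI h1 hB₀.le hlen,
    hasMajorantHom_e2_of_ineq342 hI h2 hB₀.le hlen, hasMajorantHom_e3_of_ineq342 hI h3 hB₀.le hlen⟩

end Joint

end Literature.MathematicalPhysics.QuantumFieldTheory.Balaban1983to89.B9Thm37GlueCor36
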